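import Summits.HodgeConjecture.HodgeConjecture.Theorems.Ring2AbelianAllAndreFibreGysinRational
import Literature.AlgebraicGeometry.HodgeTheory.CycleClassesAbsoluteHodgeOfCanonical
import Literature.AlgebraicGeometry.HodgeTheory.SupportedClassesRationalProofs
import Literature.AlgebraicGeometry.HodgeTheory.MotivatedClassesRationalSpan
import Literature.AlgebraicGeometry.HodgeTheory.HodgeTypeConjugation
import HarnessLib

/-!
# Ring 2 · sub-cell AbelianAll (ALL ABELIAN VARIETIES), André axis, part XXXVI-g — THE HODGE CONJECTURE FOR THE TOTAL SPACE IS THE HODGE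
# CONJECTURE FOR THE CLASSES DYING ON ONE FIBRE — with NO fibrewise multiplication: granted `HC^{p+1}(X_t)` and the lift `(L)_t(p+1)`,
# and UNCONDITIONALLY for compact pencils of abelian curves, surfaces and threefolds

HONEST FRAMING (page 1, verbatim): **research route, not a corollary; conditional on HC_CM plus one named
minimal statement.** Cell line: research route conditional on HC_CM; not a corollary; Q11.4-sentence-2
already refuted in dim ≥ 3. Nothing in this file proves a case of the Hodge conjecture for an abelian variety; `HC_CM` =
`Theses.RankFourFaces.CMAbelianHodge` is a BINDER (explicit hypothesis) of the one row where it occurs; item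
`Theses.RankFourFaces.CMToAbelian` (stmt-16267) OPEN and not closed here. Seat `pub-hodge-ring2-ab-andre-2`, gen 28; brief (iii).

## What is proved (theorems only; no definition, no named fact, no sorry)

Part XXXVI-d §4 proved, for a compact pencil `f : 𝒳 ⟶ S` of abelian `d`-folds CARRYING A FIBREWISE MULTIPLICATION `ν` (the θ∀-datum),
that granted `HC^{p+1}(X_t)` and `(L)_t(p+1)` the Hodge conjecture for `𝒳` in degree `2(p+1)` is equivalent to the algebraicity of the rational
`(p+1,p+1)`-classes DYING on `X_t` — the datum entering only through the algebraic top projector `e₀`. THIS FILE removes the datum: the top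
piece is split off by RATIONAL DESCENT instead of by `e₀`.
§1 **`exists_rational_algebraic_sub_mem_ker`** — if a RATIONAL class `y ∈ H^{2q}(𝒳)` lies in `N^q(𝒳) + ker j_t^*`, then `y = η + κ` with `η`
a RATIONAL algebraic class and `κ ∈ ker j_t^*` (rational): both summands are complex spans of rational classes (`N^q` by the cycle classes,
`algebraicClasses_le_span_isRationalClass`; `ker j_t^*` by `mem_span_isRationalClass_of_map_eq_zero` and
`span_isRationalClass_eq_top_of_isSmoothProjective_holds`), and a rational class in the complex span of rational classes is a RATIONAL
combination of them (`IsRationalClass.exists_finset_sum_smul_rat_of_mem_span` — the injectivity of `H(ℚ) ⊗ ℂ → H(ℂ)`).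
§2 **`forall_hodge_mem_iff_forall_hodge_ker'`** — for EVERY compact abelian pencil, every point `t` and every `q`: granted `HC^q(X_t)` and
`(L)_t(q)`, **`HC^q(𝒳) ⟺` every rational `(q,q)`-class of `𝒳` dying on `X_t` is algebraic** (`η` is of type `(q,q)` as an algebraic class,
so `κ = y − η` is a rational `(q,q)`-class dying on `X_t`).
§3 **`forall_hodge_mem_iff_forall_hodge_ker_of_HC_CM'`** (`HC_CM` BINDER + lift node (L) at a CM point) and
**`forall_hodge_mem_iff_forall_hodge_ker_of_relDim_le_three'`** — **UNCONDITIONALLY, for every compact pencil of abelian curves, surfaces or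
threefolds, every point `t` and every degree: a rational `(q,q)`-class of the total space `𝒳` (a smooth projective variety of dimension
`≤ 4`) is algebraic iff every such class vanishing on the fibre `X_t` is.** Smallest open instance: `d = 3`, `q = 2` — the `(2,2)`-classes
of a FOURFOLD fibred in abelian threefolds over a curve that die on one fibre (print: `H¹(S, R³ f_*) ⊕ H²(S, R² f_*)`, the second summand
being algebraic by part XXIX-h).

## Honest status

No displayed datum; no node is born; nothing is minimal; nothing here is fact-free progress on `HC_AV`; N104 untouched. `ker j_t^*` does
not depend on `t` (part XVII, `ker j_t^* = ker j_s^*`), so "dying on one fibre" = "dying on every fibre". NOT claimed: the Hodge conjecture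
for any class dying on a fibre when `d ≥ 3`, `q ≥ 2`.

References: Zucker1979 (§1); VoisinHodgeI2002 (§7.1.1, §11.3); VoisinHodgeII2003 (§8.2.1 Thm. 8.21, §10.2.3); HatcherAT2002 (§3.1 Thm. 3.2,
p. 198); Milne2020HodgeClassesAV (Prop. 1); Lieberman1968 (Thm. 1); Andre1996Motifs (§6.3 Remarque 2, p. 33).
-/

noncomputable section

set_option linter.dupNamespace false

namespace Summit.HodgeConjecture.HodgeConjecture.Ring2.AbelianAll

open CategoryTheory CategoryTheory.Limits AlgebraicGeometry
open Literature.AlgebraicGeometry Literature.AlgebraicGeometry.Motives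
open Literature.AlgebraicGeometry.HodgeTheory
open Literature.AlgebraicGeometry.Deligne1982 (cmLocus)
open Summit.HodgeConjecture.HodgeConjecture
open Summit.HodgeConjecture.HodgeConjecture.Theses

variable {𝒳 S : SchemeOver ℂ} {d : ℕ} {f : 𝒳 ⟶ S}

/-! ## §1 Rational descent: a rational class in `N^q(𝒳) + ker j_t^*` splits rationally -/

/-- **A RATIONAL class in `N^q(𝒳) + ker j_t^*` is a rational algebraic class plus a rational class dying on `X_t`.** Both summands are complex
spans of rational classes — `N^q(𝒳)` by the cycle classes, `ker j_t^*` because `H^{2q}(𝒳(ℂ); ℂ)` is spanned by rational classes and `j_t^*`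
is defined over `ℚ` — and a rational class in the complex span of rational classes is a rational combination of them (injectivity of
`H^{2q}(𝒳; ℚ) ⊗ ℂ → H^{2q}(𝒳; ℂ)`). [cite: VoisinHodgeI2002, §7.1.1] [cite: HatcherAT2002, §3.1 Thm. 3.2 and p. 198] -/
theorem exists_rational_algebraic_sub_mem_ker (hf : IsCompactAbelianPencil f d) (t : ComplexPoints S) {q : ℕ}
    {y : complexBetti 𝒳 (2 * q)} (hyQ : IsRationalClass y)
    (hy : y ∈ algebraicClasses 𝒳 q ⊔ LinearMap.ker (complexBetti.map (fiberι f t) (2 * q)).hom) :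
    ∃ η : complexBetti 𝒳 (2 * q), IsRationalClass η ∧ η ∈ algebraicClasses 𝒳 q ∧
      complexBetti.map (fiberι f t) (2 * q) (y - η) = 0 := by
  classical
  have h𝒳 := hf.isSmoothProjective_total
  set N : Submodule ℂ (complexBetti 𝒳 (2 * q)) := algebraicClasses 𝒳 q with hN
  set K : Submodule ℂ (complexBetti 𝒳 (2 * q)) := LinearMap.ker (complexBetti.map (fiberι f t) (2 * q)).hom with hK
  -- the rational members of the two summands
  set T : Set (complexBetti 𝒳 (2 * q)) := {v | IsRationalClass v ∧ (v ∈ N ∨ v ∈ K)} with hT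
  have hTQ : ∀ v ∈ T, IsRationalClass v := fun v hv ↦ hv.1
  -- both summands lie in the complex span of `T`
  have hNle : N ≤ Submodule.span ℂ T := fun v hv ↦ by
    have h := algebraicClasses_le_span_isRationalClass h𝒳 q hv
    refine Submodule.span_mono (fun w hw ↦ ?_) h
    rw [hT, Set.mem_setOf_eq]
    exact ⟨hw.1, Or.inl hw.2⟩
  have hKle : K ≤ Submodule.span ℂ T := fun v hv ↦ by
    have hv0 : Literature.AlgebraicTopology.SingularHomology.singularCohomology.map ℂ ℂ
        (AlgPoints.mapContinuous (L := ℂ) (fiberι f t)) (2 * q) v = 0 := LinearMap.mem_ker.1 hv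
    have h := mem_span_isRationalClass_of_map_eq_zero (AlgPoints.mapContinuous (L := ℂ) (fiberι f t))
      (span_isRationalClass_eq_top_of_isSmoothProjective_holds.mem_span h𝒳 v) hv0
    refine Submodule.span_mono (fun w hw ↦ ?_) h
    rw [hT, Set.mem_setOf_eq]
    exact ⟨hw.1, Or.inr (LinearMap.mem_ker.2 hw.2)⟩
  have hyT : y ∈ Submodule.span ℂ T := (sup_le hNle hKle) hy
  -- rational descent
  obtain ⟨s, c, hsT, hys⟩ := hyQ.exists_finset_sum_smul_rat_of_mem_span hTQ hyT
  -- split the rational combination along `N`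
  set η : complexBetti 𝒳 (2 * q) := ∑ v ∈ s.filter (· ∈ N), ((c v : ℚ) : ℂ) • v with hη
  set κ : complexBetti 𝒳 (2 * q) := ∑ v ∈ s.filter (· ∉ N), ((c v : ℚ) : ℂ) • v with hκ
  have hsum : y = η + κ := by rw [hys, hη, hκ, Finset.sum_filter_add_sum_filter_not]
  refine ⟨η, ?_, ?_, ?_⟩
  · -- rational: a finite rational combination of rational classes
    refine Finset.sum_induction _ (fun x ↦ IsRationalClass x) (fun a b ha hb ↦ ha.add hb) IsRationalClass.zero ?_
    intro v hv
    exact (hTQ v (hsT (Finset.mem_filter.1 hv).1)).smul (c v)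
  · exact Submodule.sum_mem _ fun v hv ↦ Submodule.smul_mem _ _ (Finset.mem_filter.1 hv).2
  · rw [hsum, add_sub_cancel_left]
    refine LinearMap.mem_ker.1 (Submodule.sum_mem _ fun v hv ↦ Submodule.smul_mem _ _ ?_)
    obtain ⟨hvs, hvN⟩ := Finset.mem_filter.1 hv
    rcases (hsT hvs).2 with h | h
    · exact absurd h hvN
    · exact h

/-! ## §2 The Hodge conjecture for the total space is the Hodge conjecture for the classes dying on one fibre -/

/-- **`HC^q(𝒳) ⟺ HC(ker j_t^* ∩ H^{2q}(𝒳))`, granted `HC^q(X_t)` and `(L)_t(q)` — NO fibrewise multiplication.** For a compact pencil of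
abelian `d`-folds, a point `t` and a degree `q`: if the rational `(q,q)`-classes of the fibre `X_t` are algebraic and the lift `(L)_t(q)` holds,
then every rational `(q,q)`-class `y` of `𝒳` is algebraic iff every such class DYING on `X_t` is: `j_t^* y` is a Hodge class of `X_t`,
hence algebraic, so `y ∈ N^q(𝒳) + ker j_t^*`; by §1 `y = η + κ` with `η` rational algebraic — hence of type `(q,q)` — and `κ = y − η` a
rational `(q,q)`-class dying on `X_t`. Part XXXVI-d §4 without the θ∀-datum. [cite: Milne2020HodgeClassesAV, Prop. 1 (pp. 7–8)]
[cite: VoisinHodgeI2002, §7.1.1 and §11.3] [cite: Zucker1979, §1] -/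
theorem forall_hodge_mem_iff_forall_hodge_ker' (hf : IsCompactAbelianPencil f d) (t : ComplexPoints S) {q : ℕ}
    (hfib : ∀ c : complexBetti (fiberOver f t) (2 * q), IsRationalClass c →
      IsOfHodgeType d (fiberOver f t) (2 * q) q q c → c ∈ algebraicClasses (fiberOver f t) q)
    (hL : (algebraicClasses (fiberOver f t) q).comap (complexBetti.map (fiberι f t) (2 * q)).hom ≤
      algebraicClasses 𝒳 q ⊔ LinearMap.ker (complexBetti.map (fiberι f t) (2 * q)).hom) :
    (∀ y : complexBetti 𝒳 (2 * q), IsRationalClass y → IsOfHodgeType (d + 1) 𝒳 (2 * q) q q y → y ∈ algebraicClasses 𝒳 q) ↔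
      ∀ y : complexBetti 𝒳 (2 * q), complexBetti.map (fiberι f t) (2 * q) y = 0 → IsRationalClass y →
        IsOfHodgeType (d + 1) 𝒳 (2 * q) q q y → y ∈ algebraicClasses 𝒳 q := by
  have h𝒳 := hf.isSmoothProjective_total
  have hXt := hf.isSmoothProjective_fiberOver t
  refine ⟨fun h y _ hQ hH ↦ h y hQ hH, fun h y hQ hH ↦ ?_⟩
  -- `j_t^* y` is a Hodge class of the fibre, hence algebraic
  have hjy : complexBetti.map (fiberι f t) (2 * q) y ∈ algebraicClasses (fiberOver f t) q :=
    hfib _ (hQ.map (AlgPoints.mapContinuous (L := ℂ) (fiberι f t))) (hH.map_of_isSmoothProjective hXt h𝒳 (fiberι f t))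
  have hy : y ∈ algebraicClasses 𝒳 q ⊔ LinearMap.ker (complexBetti.map (fiberι f t) (2 * q)).hom := hL hjy
  obtain ⟨η, hηQ, hηN, hκ⟩ := exists_rational_algebraic_sub_mem_ker hf t hQ hy
  have hηH : IsOfHodgeType (d + 1) 𝒳 (2 * q) q q η := isOfHodgeType_of_mem_algebraicClasses_of_isSmoothProjective h𝒳 q hηN
  have hκQ : IsRationalClass (y - η) := by
    have h' := hQ.add (hηQ.smul (-1 : ℚ))
    rwa [Rat.cast_neg, Rat.cast_one, neg_one_smul, ← sub_eq_add_neg] at h'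
  have hκalg : y - η ∈ algebraicClasses 𝒳 q := h (y - η) hκ hκQ (hH.sub h𝒳 hηH)
  rw [show y = η + (y - η) by abel]
  exact Submodule.add_mem _ hηN hκalg

/-! ## §3 At a CM point granted `HC_CM` and the lift; unconditionally in relative dimension `≤ 3` -/

/-- **AT A CM FIBRE, GRANTED `HC_CM` (BINDER) AND THE LIFT NODE (L) `CMFibreAlgebraicLift`, for EVERY compact abelian pencil (no fibrewise
multiplication): a rational `(q,q)`-class of the total space `𝒳` is algebraic iff every such class dying on `X_t` is.**
research route, not a corollary; conditional on HC_CM plus one named minimal statement. [cite: Andre1996Motifs, Lemme 6.3.1 (p. 31) and Remarque 2 (p. 33)]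
[cite: Milne2020HodgeClassesAV, Prop. 1 (pp. 7–8)] -/
theorem forall_hodge_mem_iff_forall_hodge_ker_of_HC_CM' (hCM : RankFourFaces.CMAbelianHodge) (hLift : CMFibreAlgebraicLift)
    (hf : IsCompactAbelianPencil f d) {t : ComplexPoints S} (ht : t ∈ cmLocus f d) (q : ℕ) :
    (∀ y : complexBetti 𝒳 (2 * q), IsRationalClass y → IsOfHodgeType (d + 1) 𝒳 (2 * q) q q y → y ∈ algebraicClasses 𝒳 q) ↔
      ∀ y : complexBetti 𝒳 (2 * q), complexBetti.map (fiberι f t) (2 * q) y = 0 → IsRationalClass y →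
        IsOfHodgeType (d + 1) 𝒳 (2 * q) q q y → y ∈ algebraicClasses 𝒳 q := by
  obtain ⟨A₀, ⟨e₀⟩, hdim, hcm⟩ := ht
  exact forall_hodge_mem_iff_forall_hodge_ker' hf t
    (fun c hc hcpp ↦ Ring2Transport.mem_algebraicClasses_of_cmChart hCM A₀ e₀ hdim hcm hc hcpp)
    (cmFibreAlgebraicLift_iff_comap_le_sup.1 hLift f hf q t ⟨A₀, ⟨e₀⟩, hdim, hcm⟩)

/-- **UNCONDITIONALLY, FOR EVERY COMPACT PENCIL OF ABELIAN CURVES, SURFACES OR THREEFOLDS (`d ≤ 3`), every point `t`, every degree `2q`: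
a rational `(q,q)`-class of the total space `𝒳` (smooth projective of dimension `≤ 4`) is algebraic iff every such class vanishing on the
fibre `X_t` is** — the Hodge conjecture of the fibre (dimension `≤ 3`) and the lift (part XVIII-f) are tree theorems; no datum is
displayed. SMALLEST OPEN INSTANCE (brief (iii), as a find-the-cycle problem): `d = 3`, `q = 2` — the rational `(2,2)`-classes of a FOURFOLD
fibred in abelian threefolds over a smooth projective curve that die on one (equivalently, every) fibre.
[cite: VoisinHodgeII2003, §8.2.1 Thm. 8.21 and §10.2.3] [cite: Zucker1979, §1] [cite: Lieberman1968, Thm. 1] -/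
theorem forall_hodge_mem_iff_forall_hodge_ker_of_relDim_le_three' (hd : d ≤ 3) (hf : IsCompactAbelianPencil f d) (t : ComplexPoints S)
    (q : ℕ) :
    (∀ y : complexBetti 𝒳 (2 * q), IsRationalClass y → IsOfHodgeType (d + 1) 𝒳 (2 * q) q q y → y ∈ algebraicClasses 𝒳 q) ↔
      ∀ y : complexBetti 𝒳 (2 * q), complexBetti.map (fiberι f t) (2 * q) y = 0 → IsRationalClass y →
        IsOfHodgeType (d + 1) 𝒳 (2 * q) q q y → y ∈ algebraicClasses 𝒳 q :=
  forall_hodge_mem_iff_forall_hodge_ker' hf t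
    (fun c hc hcpp ↦ hodgeClasses_algebraic_of_dim_le_three_holds hd (hf.isSmoothProjective_fiberOver t) q c hc hcpp)
    (comap_le_sup_of_relDim_le_three hd hf t q)

end Summit.HodgeConjecture.HodgeConjecture.Ring2.AbelianAll

end
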